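import Mathlib.Analysis.SpecialFunctions.Pow.Real
import Summits.MatrixMultiplication.MatrixMultiplication.Theses.ConeDesigns
import Literature.Computability.AlgebraicComplexity.GroupTheoreticMatMul
import Literature.Computability.AlgebraicComplexity.GroupTheoreticMatMulProofs

/-!
# `ConeDesigns.ConeCertificate` (stmt-MatrixMultiplication-9763) — proved

Route `MatrixMultiplication/ConeDesigns`, support item `ConeCertificate` (CERTIFIED EXPONENT): for
every prime `q`, rank `n` and cone STPP design of `N` triangles `(aᵢ, bᵢ, cᵢ)` of nonzero vectors of
`(ZMod q)^n` — the punctured lines `Aᵢ = 𝔽_q^× aᵢ`, `Bᵢ = 𝔽_q^× bᵢ`, `Cᵢ = 𝔽_q^× cᵢ` forming an STPP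
family — one has `N·(q − 1)^{ω(ℂ)} ≤ q^n`.

Proof (Cohn–Kleinberg–Szegedy–Umans 2005, Thm. 5.5, abelian case = Blasiak et al. 2017, (1.1) — the
DISCHARGED tree fact `CohnKleinbergSzegedyUmans2005_5_5_abelian_holds`) applied to the finite abelian
group `H = Fin n → ZMod q`: `Σᵢ (|Aᵢ||Bᵢ||Cᵢ|)^{ω/3} ≤ |H| = q^n`, and each punctured line has exactly
`q − 1` elements (`t ↦ t • v` is injective on `ZMod q` for `v ≠ 0`, its image contains `0`), so the
left-hand side is `N·((q−1)³)^{ω/3} = N·(q−1)^ω`.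
-/

namespace Summit.MatrixMultiplication.MatrixMultiplication.Theorems

open scoped BigOperators
open Literature.Computability.AlgebraicComplexity

/-- A punctured line `𝔽_q^× v = {t • v : t ∈ ZMod q} \ {0}` through a nonzero vector `v` of
`(ZMod q)^n` (`q` prime) has exactly `q − 1` elements: `t ↦ t • v` is injective and `0 • v = 0`.
[folklore] -/
theorem card_puncturedLine_zmod {n q : ℕ} [Fact q.Prime] {v : Fin n → ZMod q} (hv : v ≠ 0) :
    (((Finset.univ : Finset (ZMod q)).image (fun t => t • v)).erase 0).card = q - 1 := by
  rw [Finset.card_erase_of_mem, Finset.card_image_of_injective _ (smul_left_injective (ZMod q) hv),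
    Finset.card_univ, ZMod.card]
  exact Finset.mem_image.2 ⟨0, Finset.mem_univ _, zero_smul _ _⟩

/-- **`ConeCertificate` holds** (route ConeDesigns, stmt-MatrixMultiplication-9763): for every
prime `q`, rank `n` and cone STPP design of `N` triangles of nonzero vectors in `(ZMod q)^n`,
`N·(q − 1)^{ω(ℂ)} ≤ q^n`.  From CKSU 2005 Thm. 5.5 (abelian case; tree theorem
`CohnKleinbergSzegedyUmans2005_5_5_abelian_holds`) in `H = Fin n → ZMod q` (`|H| = q^n`), each
punctured line having `q − 1` elements (`card_puncturedLine_zmod`), and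
`((q−1)³)^{ω/3} = (q−1)^ω`. [folklore] -/
theorem coneCertificate_proof :
    Summit.MatrixMultiplication.MatrixMultiplication.Theses.ConeDesigns.ConeCertificate := by
  unfold Summit.MatrixMultiplication.MatrixMultiplication.Theses.ConeDesigns.ConeCertificate
  intro n q hq N a b c hne hS
  classical
  -- CKSU 2005, Thm. 5.5 (abelian case) in H = (ZMod q)^n: Σᵢ (|Aᵢ||Bᵢ||Cᵢ|)^{ω/3} ≤ |H|
  have hck := CohnKleinbergSzegedyUmans2005_5_5_abelian_holds (Fin n → ZMod q) N _ _ _ hS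
  have hA : ∀ i : Fin N,
      (((Finset.univ : Finset (ZMod q)).image (fun t => t • a i)).erase 0).card = q - 1 :=
    fun i => card_puncturedLine_zmod (hne i).1
  have hB : ∀ i : Fin N,
      (((Finset.univ : Finset (ZMod q)).image (fun t => t • b i)).erase 0).card = q - 1 :=
    fun i => card_puncturedLine_zmod (hne i).2.1
  have hC : ∀ i : Fin N,
      (((Finset.univ : Finset (ZMod q)).image (fun t => t • c i)).erase 0).card = q - 1 :=
    fun i => card_puncturedLine_zmod (hne i).2.2
  simp only [hA, hB, hC, Finset.sum_const, Finset.card_univ, Fintype.card_fin, nsmul_eq_mul,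
    Fintype.card_pi, ZMod.card, Finset.prod_const] at hck
  -- arithmetic: ((q-1)³)^{ω/3} = (q-1)^ω and |H| = q^n
  have hq1 : 1 ≤ q := hq.out.one_lt.le
  have hx : (0 : ℝ) ≤ (q : ℝ) - 1 := by
    have : (1 : ℝ) ≤ q := by exact_mod_cast hq1
    linarith
  have hpow : (((q - 1) * (q - 1) * (q - 1) : ℕ) : ℝ) ^ (omega ℂ / 3) = ((q : ℝ) - 1) ^ omega ℂ := by
    have h3 : (((q - 1) * (q - 1) * (q - 1) : ℕ) : ℝ) = ((q : ℝ) - 1) ^ (3 : ℕ) := by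
      push_cast [Nat.cast_sub hq1]
      ring
    rw [h3, ← Real.rpow_natCast_mul hx]
    congr 1
    push_cast
    ring
  rw [hpow] at hck
  rw [Real.rpow_natCast]
  exact_mod_cast hck

end Summit.MatrixMultiplication.MatrixMultiplication.Theorems
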